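import Mathlib
import Literature.NumberTheory.Transcendental.AssociatorsLinearizationProofs
import HarnessLib

/-!
# Associators IX: the hexagons in degree `≤ 2` [BarnatanDancso2011, §3; Furusho2010, Thm 10]

Eighth proofs file towards [Furusho2010, Thm 1] (`furusho_pentagon_hexagon`). The minimal-degree
argument of [BarnatanDancso2011, §3] starts at degree `3` ("By the simple computation in low
degrees mentioned before, we know that `m ≥ 3`"); in degree `2` the hexagons hold for a
group-like solution of the pentagon exactly when `μ² = 24 c₂(φ)` ([Furusho2010, proof of
Thm 10]: "By calculating the coefficient of `XY` in (13) for `(μ, φ)`, we get `3c₂(φ) - μ²/8 = 0`").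
We verify the two hexagon equations `NCSeries.DrinfeldHexagon`, `NCSeries.DrinfeldHexagonB` in
the truncations `U𝔞₄/(deg > N)` for `N ≤ 2` (`NCSeries.hexagons_of_le_two`): in weight `≤ 2`
a commutator-group-like `φ` evaluates to `φ(a, b) = 1 + c₂(φ)(ab - ba)`, the exponentials are
quadratic polynomials, and the difference of the two sides of each hexagon is
`(3c₂ - μ²/8)(t₀₂t₁₂ - t₁₂t₀₂)` by the infinitesimal braid relations.

No named facts are introduced.

## References

* D. Bar-Natan, Z. Dancso, *Pentagon and hexagon equations following Furusho*, Proc. AMS 140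
  (2012), §3. [BarnatanDancso2011]
* H. Furusho, *Pentagon and hexagon equations*, Ann. of Math. 171 (2010), §2, proof of Thm 10.
  [Furusho2010]
-/

noncomputable section

open scoped BigOperators

namespace Literature.NumberTheory.Transcendental

universe u v

namespace NCSeries

/-! ## 1. Evaluations in weight `≤ 2` -/

section EvalTwo

variable {α : Type u} {R : Type v} [CommSemiring R] {A : Type*} [Semiring A] [Algebra R A]
  [Fintype α]

/-- In weight `≤ 0`: `evalTrunc 0 v φ = c_∅(φ) · 1`. [folklore] -/
theorem evalTrunc_zero_eq (v : α → A) (φ : NCSeries α R) : evalTrunc 0 v φ = φ [] • (1 : A) := by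
  unfold evalTrunc
  rw [Finset.sum_range_one, Fintype.sum_unique, List.ofFn_zero, List.map_nil, List.prod_nil]

/-- In weight `≤ 2`:
`evalTrunc 2 v φ = c_∅ · 1 + Σ_a c_a · v(a) + Σ_{a,b} c_{ab} · v(a) v(b)`. [folklore] -/
theorem evalTrunc_two_eq (v : α → A) (φ : NCSeries α R) :
    evalTrunc 2 v φ = φ [] • (1 : A) + ∑ a, φ [a] • v a + ∑ a, ∑ b, φ [a, b] • (v a * v b) := by
  have h1 := evalTrunc_one_eq v φ
  unfold evalTrunc at h1 ⊢
  rw [Finset.sum_range_succ, h1]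
  congr 1
  rw [← (finTwoArrowEquiv α).symm.sum_comp, Fintype.sum_prod_type]
  refine Finset.sum_congr rfl fun a _ => Finset.sum_congr rfl fun b _ => ?_
  simp [finTwoArrowEquiv, List.ofFn_succ]

end EvalTwo

/-! ## 2. Commutator-group-like series in weight `≤ 2` -/

section GroupLikeTwo

variable {k : Type u} [CommRing k] [Algebra ℚ k]

/-- For a group-like `φ` with `c_X = c_Y = 0`: `c_{XX} = c_{YY} = 0` and `c_{YX} = -c_{XY}`.
[folklore] -/
theorem IsGroupLike.weight_two {φ : NCSeries Bool k} (hg : IsGroupLike φ) (h0 : φ [false] = 0)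
    (h1 : φ [true] = 0) :
    φ [false, false] = 0 ∧ φ [true, true] = 0 ∧ φ [true, false] = -φ [false, true] := by
  refine ⟨hg.apply_replicate_eq_zero h0 2 (by omega), hg.apply_replicate_eq_zero h1 2 (by omega), ?_⟩
  have h := hg.apply_singleton_mul false true
  rw [h0, zero_mul] at h
  exact eq_neg_of_add_eq_zero_right h.symm

/-- **`φ(a, b) = 1 + c₂(ab - ba)` in weight `≤ 2`** for a group-like `φ` with
`c_X = c_Y = 0`. [cite: Furusho2010, Thm 10] -/
theorem IsGroupLike.evalTrunc_two {φ : NCSeries Bool k} (hg : IsGroupLike φ) (h0 : φ [false] = 0)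
    (h1 : φ [true] = 0) {A : Type*} [Ring A] [Algebra k A] (a b : A) :
    evalTrunc 2 (bsub a b) φ = 1 + φ [false, true] • (a * b - b * a) := by
  obtain ⟨hff, htt, htf⟩ := hg.weight_two h0 h1
  rw [evalTrunc_two_eq, Fintype.sum_bool, Fintype.sum_bool, Fintype.sum_bool, Fintype.sum_bool,
    hg.1, h0, h1, hff, htt, htf]
  simp only [bsub_true, bsub_false, one_smul, zero_smul, add_zero, neg_smul, smul_sub]
  abel

omit [Algebra ℚ k] in
/-- In weight `≤ 1` every series with constant term `1` and no linear terms evaluates to `1`.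
[folklore] -/
theorem evalTrunc_one_eq_one {φ : NCSeries Bool k} (hφ : φ [] = 1) (h0 : φ [false] = 0)
    (h1 : φ [true] = 0) {A : Type*} [Ring A] [Algebra k A] (a b : A) :
    evalTrunc 1 (bsub a b) φ = 1 := by
  rw [evalTrunc_one_eq, Fintype.sum_bool, hφ, h0, h1]
  simp

omit [Algebra ℚ k] in
/-- In weight `≤ 0` every series with constant term `1` evaluates to `1`. [folklore] -/
theorem evalTrunc_zero_eq_one {φ : NCSeries Bool k} (hφ : φ [] = 1) {A : Type*} [Ring A]
    [Algebra k A] (a b : A) : evalTrunc 0 (bsub a b) φ = 1 := by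
  rw [evalTrunc_zero_eq, hφ, one_smul]

end GroupLikeTwo

/-! ## 3. Truncated exponentials in weight `≤ 2` -/

section ExpTwo

variable {k : Type u} [CommRing k] [Algebra ℚ k] {ι : Type v}

/-- `expT x = 1` in `U𝔞/(deg > 0)`. [folklore] -/
theorem expT_level_zero (x : DrinfeldKohnoTrunc k ι 0) : DrinfeldKohnoTrunc.expT x = 1 := by
  unfold DrinfeldKohnoTrunc.expT
  simp

/-- `expT x = 1 + x` in `U𝔞/(deg > 1)`. [folklore] -/
theorem expT_level_one (x : DrinfeldKohnoTrunc k ι 1) : DrinfeldKohnoTrunc.expT x = 1 + x := by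
  unfold DrinfeldKohnoTrunc.expT
  simp [Finset.sum_range_succ]

/-- `expT x = 1 + x + x²/2` in `U𝔞/(deg > 2)`. [folklore] -/
theorem expT_level_two (x : DrinfeldKohnoTrunc k ι 2) :
    DrinfeldKohnoTrunc.expT x = 1 + x + algebraMap ℚ k (1 / 2) • x ^ 2 := by
  unfold DrinfeldKohnoTrunc.expT
  simp [Finset.sum_range_succ, Nat.factorial]

end ExpTwo

/-! ## 4. The hexagons in weight `≤ 2` -/

section HexLow

variable {k : Type u} [CommRing k]

/-- A normal-form multiplication step modulo weight `3`: in `U𝔞₄/(deg > 2)`,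
`(1 + L + Q)(1 + A + B) = 1 + (L + A) + (Q + B + LA)` for `L, A` of weight `≥ 1` and `Q, B` of
weight `≥ 2`. [folklore] -/
theorem mul_step_two {L Q A B : DrinfeldKohnoTrunc k (Fin 4) 2}
    (hL : L ∈ (DrinfeldKohnoTrunc.wFil 1 : Submodule k (DrinfeldKohnoTrunc k (Fin 4) 2)))
    (hQ : Q ∈ (DrinfeldKohnoTrunc.wFil 2 : Submodule k (DrinfeldKohnoTrunc k (Fin 4) 2)))
    (hA : A ∈ (DrinfeldKohnoTrunc.wFil 1 : Submodule k (DrinfeldKohnoTrunc k (Fin 4) 2)))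
    (hB : B ∈ (DrinfeldKohnoTrunc.wFil 2 : Submodule k (DrinfeldKohnoTrunc k (Fin 4) 2))) :
    (1 + L + Q) * (1 + A + B) = 1 + (L + A) + (Q + B + L * A) := by
  have z1 : L * B = 0 := DrinfeldKohnoTrunc.mul_eq_zero_of_wFil (by omega) hL hB
  have z2 : Q * A = 0 := DrinfeldKohnoTrunc.mul_eq_zero_of_wFil (by omega) hQ hA
  have z3 : Q * B = 0 := DrinfeldKohnoTrunc.mul_eq_zero_of_wFil (by omega) hQ hB
  simp only [add_mul, mul_add, one_mul, mul_one, z1, z2, z3, add_zero]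
  abel

/-- The closed form of the product after a step lies again in normal form. [folklore] -/
theorem mul_mem_wFil_two {L A : DrinfeldKohnoTrunc k (Fin 4) 2}
    (hL : L ∈ (DrinfeldKohnoTrunc.wFil 1 : Submodule k (DrinfeldKohnoTrunc k (Fin 4) 2)))
    (hA : A ∈ (DrinfeldKohnoTrunc.wFil 1 : Submodule k (DrinfeldKohnoTrunc k (Fin 4) 2))) :
    L * A ∈ (DrinfeldKohnoTrunc.wFil 2 : Submodule k (DrinfeldKohnoTrunc k (Fin 4) 2)) := by
  have h := DrinfeldKohnoTrunc.mul_mem_wFil hL hA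
  exact h

local notation "𝔱₂" => (DrinfeldKohnoTrunc.t k 2 : Fin 4 → Fin 4 → DrinfeldKohnoTrunc k (Fin 4) 2)

/-- Products of two generators have weight `2`. [folklore] -/
theorem t_mul_t_mem_wFil_two (i j i' j' : Fin 4) :
    𝔱₂ i j * 𝔱₂ i' j' ∈ (DrinfeldKohnoTrunc.wFil 2 : Submodule k (DrinfeldKohnoTrunc k (Fin 4) 2)) :=
  mul_mem_wFil_two
    (DrinfeldKohnoTrunc.mem_wFil_one_of_mem_genSpan (DrinfeldKohnoTrunc.t_mem_genSpan i j))
    (DrinfeldKohnoTrunc.mem_wFil_one_of_mem_genSpan (DrinfeldKohnoTrunc.t_mem_genSpan i' j'))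

/-- The inverse of `1 + c(ab - ba)` in weight `≤ 2` is `1 - c(ab - ba)`. [folklore] -/
theorem ring_inverse_one_add_two (c : k) (i j i' j' : Fin 4) :
    Ring.inverse (1 + c • (𝔱₂ i j * 𝔱₂ i' j' - 𝔱₂ i' j' * 𝔱₂ i j)) =
      1 - c • (𝔱₂ i j * 𝔱₂ i' j' - 𝔱₂ i' j' * 𝔱₂ i j) := by
  have hK : c • (𝔱₂ i j * 𝔱₂ i' j' - 𝔱₂ i' j' * 𝔱₂ i j) ∈
      (DrinfeldKohnoTrunc.wFil 2 : Submodule k (DrinfeldKohnoTrunc k (Fin 4) 2)) :=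
    Submodule.smul_mem _ _ (Submodule.sub_mem _ (t_mul_t_mem_wFil_two i j i' j')
      (t_mul_t_mem_wFil_two i' j' i j))
  have z : c • (𝔱₂ i j * 𝔱₂ i' j' - 𝔱₂ i' j' * 𝔱₂ i j) * (c • (𝔱₂ i j * 𝔱₂ i' j' - 𝔱₂ i' j' * 𝔱₂ i j)) = 0 :=
    DrinfeldKohnoTrunc.mul_eq_zero_of_wFil (by omega) hK hK
  have e1 : ∀ K : DrinfeldKohnoTrunc k (Fin 4) 2, (1 + K) * (1 - K) = 1 - K * K := fun K => by
    noncomm_ring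
  have e2 : ∀ K : DrinfeldKohnoTrunc k (Fin 4) 2, (1 - K) * (1 + K) = 1 - K * K := fun K => by
    noncomm_ring
  refine ring_inverse_eq_of_mul_eq_one ?_ ?_
  · rw [e1, z, sub_zero]
  · rw [e2, z, sub_zero]

/-- **Expansion of a product of five factors in normal form** modulo weight `3`:
`Π (1 + Lᵢ + Qᵢ) = 1 + Σ Lᵢ + (Σ Qᵢ + Σ_{i<j} Lᵢ Lⱼ)` (nested). [folklore] -/
theorem prod_five_normal {L₁ Q₁ L₂ Q₂ L₃ Q₃ L₄ Q₄ L₅ Q₅ : DrinfeldKohnoTrunc k (Fin 4) 2}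
    (hL₁ : L₁ ∈ (DrinfeldKohnoTrunc.wFil 1 : Submodule k (DrinfeldKohnoTrunc k (Fin 4) 2)))
    (hQ₁ : Q₁ ∈ (DrinfeldKohnoTrunc.wFil 2 : Submodule k (DrinfeldKohnoTrunc k (Fin 4) 2)))
    (hL₂ : L₂ ∈ (DrinfeldKohnoTrunc.wFil 1 : Submodule k (DrinfeldKohnoTrunc k (Fin 4) 2)))
    (hQ₂ : Q₂ ∈ (DrinfeldKohnoTrunc.wFil 2 : Submodule k (DrinfeldKohnoTrunc k (Fin 4) 2)))
    (hL₃ : L₃ ∈ (DrinfeldKohnoTrunc.wFil 1 : Submodule k (DrinfeldKohnoTrunc k (Fin 4) 2)))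
    (hQ₃ : Q₃ ∈ (DrinfeldKohnoTrunc.wFil 2 : Submodule k (DrinfeldKohnoTrunc k (Fin 4) 2)))
    (hL₄ : L₄ ∈ (DrinfeldKohnoTrunc.wFil 1 : Submodule k (DrinfeldKohnoTrunc k (Fin 4) 2)))
    (hQ₄ : Q₄ ∈ (DrinfeldKohnoTrunc.wFil 2 : Submodule k (DrinfeldKohnoTrunc k (Fin 4) 2)))
    (hL₅ : L₅ ∈ (DrinfeldKohnoTrunc.wFil 1 : Submodule k (DrinfeldKohnoTrunc k (Fin 4) 2)))
    (hQ₅ : Q₅ ∈ (DrinfeldKohnoTrunc.wFil 2 : Submodule k (DrinfeldKohnoTrunc k (Fin 4) 2))) :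
    (1 + L₁ + Q₁) * (1 + L₂ + Q₂) * (1 + L₃ + Q₃) * (1 + L₄ + Q₄) * (1 + L₅ + Q₅) =
      1 + (L₁ + L₂ + L₃ + L₄ + L₅) +
        (Q₁ + Q₂ + L₁ * L₂ + Q₃ + (L₁ + L₂) * L₃ + Q₄ + (L₁ + L₂ + L₃) * L₄ + Q₅ +
          (L₁ + L₂ + L₃ + L₄) * L₅) := by
  have hM₂ : L₁ + L₂ ∈ (DrinfeldKohnoTrunc.wFil 1 : Submodule k (DrinfeldKohnoTrunc k (Fin 4) 2)) :=
    Submodule.add_mem _ hL₁ hL₂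
  have hR₂ : Q₁ + Q₂ + L₁ * L₂ ∈ (DrinfeldKohnoTrunc.wFil 2 : Submodule k (DrinfeldKohnoTrunc k (Fin 4) 2)) :=
    Submodule.add_mem _ (Submodule.add_mem _ hQ₁ hQ₂) (mul_mem_wFil_two hL₁ hL₂)
  have hM₃ : L₁ + L₂ + L₃ ∈ (DrinfeldKohnoTrunc.wFil 1 : Submodule k (DrinfeldKohnoTrunc k (Fin 4) 2)) :=
    Submodule.add_mem _ hM₂ hL₃
  have hR₃ : Q₁ + Q₂ + L₁ * L₂ + Q₃ + (L₁ + L₂) * L₃ ∈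
      (DrinfeldKohnoTrunc.wFil 2 : Submodule k (DrinfeldKohnoTrunc k (Fin 4) 2)) :=
    Submodule.add_mem _ (Submodule.add_mem _ hR₂ hQ₃) (mul_mem_wFil_two hM₂ hL₃)
  have hM₄ : L₁ + L₂ + L₃ + L₄ ∈ (DrinfeldKohnoTrunc.wFil 1 : Submodule k (DrinfeldKohnoTrunc k (Fin 4) 2)) :=
    Submodule.add_mem _ hM₃ hL₄
  have hR₄ : Q₁ + Q₂ + L₁ * L₂ + Q₃ + (L₁ + L₂) * L₃ + Q₄ + (L₁ + L₂ + L₃) * L₄ ∈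
      (DrinfeldKohnoTrunc.wFil 2 : Submodule k (DrinfeldKohnoTrunc k (Fin 4) 2)) :=
    Submodule.add_mem _ (Submodule.add_mem _ hR₃ hQ₄) (mul_mem_wFil_two hM₃ hL₄)
  rw [mul_step_two hL₁ hQ₁ hL₂ hQ₂]
  rw [show 1 + (L₁ + L₂) + (Q₁ + Q₂ + L₁ * L₂) = 1 + (L₁ + L₂) + (Q₁ + Q₂ + L₁ * L₂) from rfl,
    mul_step_two hM₂ hR₂ hL₃ hQ₃]
  rw [show L₁ + L₂ + L₃ = L₁ + L₂ + L₃ from rfl] at hM₃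
  rw [show (1 + (L₁ + L₂ + L₃) + (Q₁ + Q₂ + L₁ * L₂ + Q₃ + (L₁ + L₂) * L₃)) =
      1 + (L₁ + L₂ + L₃) + (Q₁ + Q₂ + L₁ * L₂ + Q₃ + (L₁ + L₂) * L₃) from rfl,
    mul_step_two hM₃ hR₃ hL₄ hQ₄, mul_step_two hM₄ hR₄ hL₅ hQ₅]

/-- Generators and their multiples are weight-one (level `2`). [folklore] -/
theorem smul_t_mem_wFil_one (c : k) (i j : Fin 4) :
    c • 𝔱₂ i j ∈ (DrinfeldKohnoTrunc.wFil 1 : Submodule k (DrinfeldKohnoTrunc k (Fin 4) 2)) :=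
  Submodule.smul_mem _ _ (DrinfeldKohnoTrunc.mem_wFil_one_of_mem_genSpan (DrinfeldKohnoTrunc.t_mem_genSpan i j))

/-- Sums of multiples of generators are weight-one (level `2`). [folklore] -/
theorem smul_t_add_mem_wFil_one (c : k) (i j i' j' : Fin 4) :
    c • (𝔱₂ i j + 𝔱₂ i' j') ∈ (DrinfeldKohnoTrunc.wFil 1 : Submodule k (DrinfeldKohnoTrunc k (Fin 4) 2)) :=
  Submodule.smul_mem _ _ (Submodule.add_mem _
    (DrinfeldKohnoTrunc.mem_wFil_one_of_mem_genSpan (DrinfeldKohnoTrunc.t_mem_genSpan i j))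
    (DrinfeldKohnoTrunc.mem_wFil_one_of_mem_genSpan (DrinfeldKohnoTrunc.t_mem_genSpan i' j')))

/-- Squares of weight-one elements have weight two. [folklore] -/
theorem smul_sq_mem_wFil_two (c : k) {x : DrinfeldKohnoTrunc k (Fin 4) 2}
    (hx : x ∈ (DrinfeldKohnoTrunc.wFil 1 : Submodule k (DrinfeldKohnoTrunc k (Fin 4) 2))) :
    c • x ^ 2 ∈ (DrinfeldKohnoTrunc.wFil 2 : Submodule k (DrinfeldKohnoTrunc k (Fin 4) 2)) := by
  rw [sq]; exact Submodule.smul_mem _ _ (mul_mem_wFil_two hx hx)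

/-- Commutator combinations `c • (ab - ba)` of generators have weight two. [folklore] -/
theorem smul_comm_mem_wFil_two (c : k) (i j i' j' : Fin 4) :
    c • (𝔱₂ i j * 𝔱₂ i' j' - 𝔱₂ i' j' * 𝔱₂ i j) ∈
      (DrinfeldKohnoTrunc.wFil 2 : Submodule k (DrinfeldKohnoTrunc k (Fin 4) 2)) :=
  Submodule.smul_mem _ _ (Submodule.sub_mem _ (t_mul_t_mem_wFil_two i j i' j') (t_mul_t_mem_wFil_two i' j' i j))

/-- The first infinitesimal braid identity used in degree `2`:
`t₀₂t₀₁ = t₀₁t₀₂ + t₁₂t₀₂ - t₀₂t₁₂`. [folklore] -/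
theorem braid_two_left : 𝔱₂ 0 2 * 𝔱₂ 0 1 = 𝔱₂ 0 1 * 𝔱₂ 0 2 + 𝔱₂ 1 2 * 𝔱₂ 0 2 - 𝔱₂ 0 2 * 𝔱₂ 1 2 := by
  have h : 𝔱₂ 0 2 * (𝔱₂ 0 1 + 𝔱₂ 1 2) = (𝔱₂ 0 1 + 𝔱₂ 1 2) * 𝔱₂ 0 2 :=
    DrinfeldKohnoTrunc.commute_t02_t01_add_t12
  rw [mul_add, add_mul] at h
  rw [← h, add_sub_cancel_right]

/-- The second identity. [folklore] -/
theorem braid_two_right : 𝔱₂ 0 1 * 𝔱₂ 1 2 = 𝔱₂ 1 2 * 𝔱₂ 0 2 - 𝔱₂ 0 2 * 𝔱₂ 1 2 + 𝔱₂ 1 2 * 𝔱₂ 0 1 := by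
  have h : 𝔱₂ 0 1 * (𝔱₂ 0 2 + 𝔱₂ 1 2) = (𝔱₂ 0 2 + 𝔱₂ 1 2) * 𝔱₂ 0 1 :=
    DrinfeldKohnoTrunc.commute_t01_t02_add_t12
  rw [mul_add, add_mul] at h
  have e : 𝔱₂ 0 1 * 𝔱₂ 1 2 = 𝔱₂ 0 2 * 𝔱₂ 0 1 + 𝔱₂ 1 2 * 𝔱₂ 0 1 - 𝔱₂ 0 1 * 𝔱₂ 0 2 := by
    rw [← h]; abel
  rw [e, braid_two_left]
  abel

end HexLow

section HexLowMain

variable {k : Type u} [CommRing k] [Algebra ℚ k]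

local notation "𝔱₂" => (DrinfeldKohnoTrunc.t k 2 : Fin 4 → Fin 4 → DrinfeldKohnoTrunc k (Fin 4) 2)

/-- **The first hexagon in degree `≤ 2`** [Furusho2010, proof of Thm 10: "calculating the
coefficient of `XY` ... `3c₂ - μ²/8 = 0`"]: for a group-like `φ` with `c_X = c_Y = 0` and
`μ² = 24 c₂(φ)`, `NCSeries.DrinfeldHexagon μ φ` holds in `U𝔞₄/(deg > 2)`.
[cite: Furusho2010, Thm 10] -/
theorem hexagon_level_two {Φ : NCSeries Bool k} (hg : IsGroupLike Φ) (h0 : Φ [false] = 0)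
    (h1 : Φ [true] = 0) {μ : k} (hμ : μ ^ 2 = 24 * Φ [false, true]) :
    DrinfeldKohnoTrunc.expT (((1 / 2 : ℚ) • μ) • (t₄ k 2 0 2 + t₄ k 2 1 2)) =
      subst₂ 2 Φ (t₄ k 2 0 2) (t₄ k 2 0 1) *
              DrinfeldKohnoTrunc.expT (((1 / 2 : ℚ) • μ) • t₄ k 2 0 2) *
            Ring.inverse (subst₂ 2 Φ (t₄ k 2 0 2) (t₄ k 2 1 2)) *
          DrinfeldKohnoTrunc.expT (((1 / 2 : ℚ) • μ) • t₄ k 2 1 2) *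
        subst₂ 2 Φ (t₄ k 2 0 1) (t₄ k 2 1 2) := by
  have h2q : (2 : k) * algebraMap ℚ k (1 / 2) = 1 := by
    rw [← map_ofNat (algebraMap ℚ k) 2, ← map_mul]; norm_num
  have hm' : ((1 / 2 : ℚ) • μ) = algebraMap ℚ k (1 / 2) * μ := Algebra.smul_def _ _
  generalize hq : algebraMap ℚ k (1 / 2) = q at h2q hm'
  generalize hc : Φ [false, true] = c at hμ
  have hkey : q * ((q * μ) * (q * μ)) = 3 * c := by
    linear_combination q ^ 3 * hμ + (3 * c * (4 * q ^ 2 + 2 * q + 1)) * h2q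
  rw [hm']
  generalize hm : q * μ = m at hkey
  dsimp only [subst₂, t₄]
  rw [hg.evalTrunc_two h0 h1, hg.evalTrunc_two h0 h1, hg.evalTrunc_two h0 h1, hc,
    ring_inverse_one_add_two, expT_level_two, expT_level_two, expT_level_two, hq]
  have f1 : (1 : DrinfeldKohnoTrunc k (Fin 4) 2) + c • (𝔱₂ 0 2 * 𝔱₂ 0 1 - 𝔱₂ 0 1 * 𝔱₂ 0 2) =
      1 + 0 + c • (𝔱₂ 0 2 * 𝔱₂ 0 1 - 𝔱₂ 0 1 * 𝔱₂ 0 2) := by rw [add_zero]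
  have f3 : (1 : DrinfeldKohnoTrunc k (Fin 4) 2) - c • (𝔱₂ 0 2 * 𝔱₂ 1 2 - 𝔱₂ 1 2 * 𝔱₂ 0 2) =
      1 + 0 + (-(c • (𝔱₂ 0 2 * 𝔱₂ 1 2 - 𝔱₂ 1 2 * 𝔱₂ 0 2))) := by rw [add_zero, ← sub_eq_add_neg]
  have f5 : (1 : DrinfeldKohnoTrunc k (Fin 4) 2) + c • (𝔱₂ 0 1 * 𝔱₂ 1 2 - 𝔱₂ 1 2 * 𝔱₂ 0 1) =
      1 + 0 + c • (𝔱₂ 0 1 * 𝔱₂ 1 2 - 𝔱₂ 1 2 * 𝔱₂ 0 1) := by rw [add_zero]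
  rw [f1, f3, f5, prod_five_normal (Submodule.zero_mem _) (smul_comm_mem_wFil_two c 0 2 0 1)
    (smul_t_mem_wFil_one m 0 2) (smul_sq_mem_wFil_two _ (smul_t_mem_wFil_one m 0 2))
    (Submodule.zero_mem _) (Submodule.neg_mem _ (smul_comm_mem_wFil_two c 0 2 1 2))
    (smul_t_mem_wFil_one m 1 2) (smul_sq_mem_wFil_two _ (smul_t_mem_wFil_one m 1 2))
    (Submodule.zero_mem _) (smul_comm_mem_wFil_two c 0 1 1 2)]
  simp only [zero_add, add_zero, zero_mul, mul_zero, sq, add_mul, mul_add, smul_add, smul_sub,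
    smul_mul_smul_comm, braid_two_left, braid_two_right]
  match_scalars <;> first | rfl | ring1 | linear_combination hkey |
    linear_combination (-1 : k) * hkey + m ^ 2 * h2q

/-- **The second hexagon in degree `≤ 2`**: under the same hypotheses
`NCSeries.DrinfeldHexagonB μ φ` holds in `U𝔞₄/(deg > 2)`. [cite: Furusho2010, Thm 10] -/
theorem hexagonB_level_two {Φ : NCSeries Bool k} (hg : IsGroupLike Φ) (h0 : Φ [false] = 0)
    (h1 : Φ [true] = 0) {μ : k} (hμ : μ ^ 2 = 24 * Φ [false, true]) :
    DrinfeldKohnoTrunc.expT (((1 / 2 : ℚ) • μ) • (t₄ k 2 0 1 + t₄ k 2 0 2)) =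
      Ring.inverse (subst₂ 2 Φ (t₄ k 2 1 2) (t₄ k 2 0 2)) *
              DrinfeldKohnoTrunc.expT (((1 / 2 : ℚ) • μ) • t₄ k 2 0 2) *
            subst₂ 2 Φ (t₄ k 2 0 1) (t₄ k 2 0 2) *
          DrinfeldKohnoTrunc.expT (((1 / 2 : ℚ) • μ) • t₄ k 2 0 1) *
        Ring.inverse (subst₂ 2 Φ (t₄ k 2 0 1) (t₄ k 2 1 2)) := by
  have h2q : (2 : k) * algebraMap ℚ k (1 / 2) = 1 := by
    rw [← map_ofNat (algebraMap ℚ k) 2, ← map_mul]; norm_num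
  have hm' : ((1 / 2 : ℚ) • μ) = algebraMap ℚ k (1 / 2) * μ := Algebra.smul_def _ _
  generalize hq : algebraMap ℚ k (1 / 2) = q at h2q hm'
  generalize hc : Φ [false, true] = c at hμ
  have hkey : q * ((q * μ) * (q * μ)) = 3 * c := by
    linear_combination q ^ 3 * hμ + (3 * c * (4 * q ^ 2 + 2 * q + 1)) * h2q
  rw [hm']
  generalize hm : q * μ = m at hkey
  dsimp only [subst₂, t₄]
  rw [hg.evalTrunc_two h0 h1, hg.evalTrunc_two h0 h1, hg.evalTrunc_two h0 h1, hc,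
    ring_inverse_one_add_two, ring_inverse_one_add_two, expT_level_two, expT_level_two,
    expT_level_two, hq]
  have f1 : (1 : DrinfeldKohnoTrunc k (Fin 4) 2) - c • (𝔱₂ 1 2 * 𝔱₂ 0 2 - 𝔱₂ 0 2 * 𝔱₂ 1 2) =
      1 + 0 + (-(c • (𝔱₂ 1 2 * 𝔱₂ 0 2 - 𝔱₂ 0 2 * 𝔱₂ 1 2))) := by rw [add_zero, ← sub_eq_add_neg]
  have f3 : (1 : DrinfeldKohnoTrunc k (Fin 4) 2) + c • (𝔱₂ 0 1 * 𝔱₂ 0 2 - 𝔱₂ 0 2 * 𝔱₂ 0 1) =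
      1 + 0 + c • (𝔱₂ 0 1 * 𝔱₂ 0 2 - 𝔱₂ 0 2 * 𝔱₂ 0 1) := by rw [add_zero]
  have f5 : (1 : DrinfeldKohnoTrunc k (Fin 4) 2) - c • (𝔱₂ 0 1 * 𝔱₂ 1 2 - 𝔱₂ 1 2 * 𝔱₂ 0 1) =
      1 + 0 + (-(c • (𝔱₂ 0 1 * 𝔱₂ 1 2 - 𝔱₂ 1 2 * 𝔱₂ 0 1))) := by rw [add_zero, ← sub_eq_add_neg]
  rw [f1, f3, f5, prod_five_normal (Submodule.zero_mem _)
    (Submodule.neg_mem _ (smul_comm_mem_wFil_two c 1 2 0 2))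
    (smul_t_mem_wFil_one m 0 2) (smul_sq_mem_wFil_two _ (smul_t_mem_wFil_one m 0 2))
    (Submodule.zero_mem _) (smul_comm_mem_wFil_two c 0 1 0 2)
    (smul_t_mem_wFil_one m 0 1) (smul_sq_mem_wFil_two _ (smul_t_mem_wFil_one m 0 1))
    (Submodule.zero_mem _) (Submodule.neg_mem _ (smul_comm_mem_wFil_two c 0 1 1 2))]
  simp only [zero_add, add_zero, zero_mul, mul_zero, sq, add_mul, mul_add, smul_add, smul_sub,
    smul_mul_smul_comm, braid_two_left, braid_two_right]
  match_scalars <;> first | rfl | ring1 | linear_combination m ^ 2 * h2q |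
    linear_combination (-1 : k) * hkey + m ^ 2 * h2q | linear_combination hkey - m ^ 2 * h2q

/-- **The first hexagon in degree `≤ 1`** (no condition on `μ`). [folklore] -/
theorem hexagon_level_one {Φ : NCSeries Bool k} (hΦ : Φ [] = 1) (h0 : Φ [false] = 0)
    (h1 : Φ [true] = 0) (μ : k) :
    DrinfeldKohnoTrunc.expT (((1 / 2 : ℚ) • μ) • (t₄ k 1 0 2 + t₄ k 1 1 2)) =
      subst₂ 1 Φ (t₄ k 1 0 2) (t₄ k 1 0 1) *
              DrinfeldKohnoTrunc.expT (((1 / 2 : ℚ) • μ) • t₄ k 1 0 2) *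
            Ring.inverse (subst₂ 1 Φ (t₄ k 1 0 2) (t₄ k 1 1 2)) *
          DrinfeldKohnoTrunc.expT (((1 / 2 : ℚ) • μ) • t₄ k 1 1 2) *
        subst₂ 1 Φ (t₄ k 1 0 1) (t₄ k 1 1 2) := by
  dsimp only [subst₂, t₄]
  rw [evalTrunc_one_eq_one hΦ h0 h1, evalTrunc_one_eq_one hΦ h0 h1, evalTrunc_one_eq_one hΦ h0 h1,
    Ring.inverse_one, expT_level_one, expT_level_one, expT_level_one]
  have z : ((1 / 2 : ℚ) • μ) • DrinfeldKohnoTrunc.t k 1 (0 : Fin 4) 2 *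
      (((1 / 2 : ℚ) • μ) • DrinfeldKohnoTrunc.t k 1 (1 : Fin 4) 2) = 0 :=
    DrinfeldKohnoTrunc.mul_eq_zero_of_wFil (N := 1) (show 1 < 1 + 1 by omega)
      (Submodule.smul_mem _ _ (DrinfeldKohnoTrunc.mem_wFil_one_of_mem_genSpan
        (DrinfeldKohnoTrunc.t_mem_genSpan 0 2)))
      (Submodule.smul_mem _ _ (DrinfeldKohnoTrunc.mem_wFil_one_of_mem_genSpan
        (DrinfeldKohnoTrunc.t_mem_genSpan 1 2)))
  simp only [one_mul, mul_one, add_mul, mul_add, z, add_zero, smul_add]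
  abel

/-- **The second hexagon in degree `≤ 1`**. [folklore] -/
theorem hexagonB_level_one {Φ : NCSeries Bool k} (hΦ : Φ [] = 1) (h0 : Φ [false] = 0)
    (h1 : Φ [true] = 0) (μ : k) :
    DrinfeldKohnoTrunc.expT (((1 / 2 : ℚ) • μ) • (t₄ k 1 0 1 + t₄ k 1 0 2)) =
      Ring.inverse (subst₂ 1 Φ (t₄ k 1 1 2) (t₄ k 1 0 2)) *
              DrinfeldKohnoTrunc.expT (((1 / 2 : ℚ) • μ) • t₄ k 1 0 2) *
            subst₂ 1 Φ (t₄ k 1 0 1) (t₄ k 1 0 2) *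
          DrinfeldKohnoTrunc.expT (((1 / 2 : ℚ) • μ) • t₄ k 1 0 1) *
        Ring.inverse (subst₂ 1 Φ (t₄ k 1 0 1) (t₄ k 1 1 2)) := by
  dsimp only [subst₂, t₄]
  rw [evalTrunc_one_eq_one hΦ h0 h1, evalTrunc_one_eq_one hΦ h0 h1, evalTrunc_one_eq_one hΦ h0 h1,
    Ring.inverse_one, expT_level_one, expT_level_one, expT_level_one]
  have z : ((1 / 2 : ℚ) • μ) • DrinfeldKohnoTrunc.t k 1 (0 : Fin 4) 2 *
      (((1 / 2 : ℚ) • μ) • DrinfeldKohnoTrunc.t k 1 (0 : Fin 4) 1) = 0 :=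
    DrinfeldKohnoTrunc.mul_eq_zero_of_wFil (N := 1) (show 1 < 1 + 1 by omega)
      (Submodule.smul_mem _ _ (DrinfeldKohnoTrunc.mem_wFil_one_of_mem_genSpan
        (DrinfeldKohnoTrunc.t_mem_genSpan 0 2)))
      (Submodule.smul_mem _ _ (DrinfeldKohnoTrunc.mem_wFil_one_of_mem_genSpan
        (DrinfeldKohnoTrunc.t_mem_genSpan 0 1)))
  simp only [one_mul, mul_one, add_mul, mul_add, z, add_zero, smul_add]
  abel

/-- **The hexagons in degree `≤ 0`**. [folklore] -/
theorem hexagon_level_zero {Φ : NCSeries Bool k} (hΦ : Φ [] = 1) (μ : k) :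
    DrinfeldKohnoTrunc.expT (((1 / 2 : ℚ) • μ) • (t₄ k 0 0 2 + t₄ k 0 1 2)) =
      subst₂ 0 Φ (t₄ k 0 0 2) (t₄ k 0 0 1) *
              DrinfeldKohnoTrunc.expT (((1 / 2 : ℚ) • μ) • t₄ k 0 0 2) *
            Ring.inverse (subst₂ 0 Φ (t₄ k 0 0 2) (t₄ k 0 1 2)) *
          DrinfeldKohnoTrunc.expT (((1 / 2 : ℚ) • μ) • t₄ k 0 1 2) *
        subst₂ 0 Φ (t₄ k 0 0 1) (t₄ k 0 1 2) := by
  dsimp only [subst₂, t₄]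
  rw [evalTrunc_zero_eq_one hΦ, evalTrunc_zero_eq_one hΦ, evalTrunc_zero_eq_one hΦ, Ring.inverse_one,
    expT_level_zero, expT_level_zero, expT_level_zero]
  simp

/-- **The second hexagon in degree `≤ 0`**. [folklore] -/
theorem hexagonB_level_zero {Φ : NCSeries Bool k} (hΦ : Φ [] = 1) (μ : k) :
    DrinfeldKohnoTrunc.expT (((1 / 2 : ℚ) • μ) • (t₄ k 0 0 1 + t₄ k 0 0 2)) =
      Ring.inverse (subst₂ 0 Φ (t₄ k 0 1 2) (t₄ k 0 0 2)) *
              DrinfeldKohnoTrunc.expT (((1 / 2 : ℚ) • μ) • t₄ k 0 0 2) *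
            subst₂ 0 Φ (t₄ k 0 0 1) (t₄ k 0 0 2) *
          DrinfeldKohnoTrunc.expT (((1 / 2 : ℚ) • μ) • t₄ k 0 0 1) *
        Ring.inverse (subst₂ 0 Φ (t₄ k 0 0 1) (t₄ k 0 1 2)) := by
  dsimp only [subst₂, t₄]
  rw [evalTrunc_zero_eq_one hΦ, evalTrunc_zero_eq_one hΦ, evalTrunc_zero_eq_one hΦ, Ring.inverse_one,
    expT_level_zero, expT_level_zero, expT_level_zero]
  simp

end HexLowMain

/-! ## 5. Level-wise forms of the pentagon and hexagon equations -/

section LevelWise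

variable {R : Type v} [CommRing R]

/-- The pentagon equation **at level `N`** (the body of `NCSeries.DrinfeldPentagon`). [folklore] -/
def PentAt (φ : NCSeries Bool R) (N : ℕ) : Prop :=
  subst₂ N φ (t₄ R N 0 1) (t₄ R N 1 2 + t₄ R N 1 3) *
      subst₂ N φ (t₄ R N 0 2 + t₄ R N 1 2) (t₄ R N 2 3) =
    subst₂ N φ (t₄ R N 1 2) (t₄ R N 2 3) *
        subst₂ N φ (t₄ R N 0 1 + t₄ R N 0 2) (t₄ R N 1 3 + t₄ R N 2 3) *
      subst₂ N φ (t₄ R N 0 1) (t₄ R N 1 2)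

/-- `DrinfeldPentagon φ ↔ ∀ N, PentAt φ N`. [folklore] -/
theorem drinfeldPentagon_iff (φ : NCSeries Bool R) : DrinfeldPentagon φ ↔ ∀ N, PentAt φ N := Iff.rfl

variable [Algebra ℚ R]

/-- The first hexagon **at level `N`** (the body of `NCSeries.DrinfeldHexagon`). [folklore] -/
def HexAt (μ : R) (φ : NCSeries Bool R) (N : ℕ) : Prop :=
  DrinfeldKohnoTrunc.expT (((1 / 2 : ℚ) • μ) • (t₄ R N 0 2 + t₄ R N 1 2)) =
    subst₂ N φ (t₄ R N 0 2) (t₄ R N 0 1) *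
            DrinfeldKohnoTrunc.expT (((1 / 2 : ℚ) • μ) • t₄ R N 0 2) *
          Ring.inverse (subst₂ N φ (t₄ R N 0 2) (t₄ R N 1 2)) *
        DrinfeldKohnoTrunc.expT (((1 / 2 : ℚ) • μ) • t₄ R N 1 2) *
      subst₂ N φ (t₄ R N 0 1) (t₄ R N 1 2)

/-- The second hexagon **at level `N`** (the body of `NCSeries.DrinfeldHexagonB`). [folklore] -/
def HexBAt (μ : R) (φ : NCSeries Bool R) (N : ℕ) : Prop :=
  DrinfeldKohnoTrunc.expT (((1 / 2 : ℚ) • μ) • (t₄ R N 0 1 + t₄ R N 0 2)) =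
    Ring.inverse (subst₂ N φ (t₄ R N 1 2) (t₄ R N 0 2)) *
            DrinfeldKohnoTrunc.expT (((1 / 2 : ℚ) • μ) • t₄ R N 0 2) *
          subst₂ N φ (t₄ R N 0 1) (t₄ R N 0 2) *
        DrinfeldKohnoTrunc.expT (((1 / 2 : ℚ) • μ) • t₄ R N 0 1) *
      Ring.inverse (subst₂ N φ (t₄ R N 0 1) (t₄ R N 1 2))

/-- `DrinfeldHexagon μ φ ↔ ∀ N, HexAt μ φ N`. [folklore] -/
theorem drinfeldHexagon_iff (μ : R) (φ : NCSeries Bool R) : DrinfeldHexagon μ φ ↔ ∀ N, HexAt μ φ N :=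
  Iff.rfl

/-- `DrinfeldHexagonB μ φ ↔ ∀ N, HexBAt μ φ N`. [folklore] -/
theorem drinfeldHexagonB_iff (μ : R) (φ : NCSeries Bool R) :
    DrinfeldHexagonB μ φ ↔ ∀ N, HexBAt μ φ N := Iff.rfl

/-- **Both hexagons hold in degree `≤ 2`** for a group-like `φ` with `c_X = c_Y = 0` and
`μ² = 24 c₂(φ)` — the base of the minimal-degree induction of [BarnatanDancso2011, §3].
[cite: BarnatanDancso2011, §3] -/
theorem hexAt_and_hexBAt_of_le_two {φ : NCSeries Bool R} (hg : IsGroupLike φ) (h0 : φ [false] = 0)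
    (h1 : φ [true] = 0) {μ : R} (hμ : μ ^ 2 = 24 * φ [false, true]) {N : ℕ} (hN : N ≤ 2) :
    HexAt μ φ N ∧ HexBAt μ φ N := by
  interval_cases N
  · exact ⟨hexagon_level_zero hg.1 μ, hexagonB_level_zero hg.1 μ⟩
  · exact ⟨hexagon_level_one hg.1 h0 h1 μ, hexagonB_level_one hg.1 h0 h1 μ⟩
  · exact ⟨hexagon_level_two hg h0 h1 hμ, hexagonB_level_two hg h0 h1 hμ⟩

end LevelWise

end NCSeries

end Literature.NumberTheory.Transcendental
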